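import Mathlib
import Literature.NumberTheory.Irrationality.RhinViola2001.Theorem31Proofs
import HarnessLib

/-!
# Rhin–Viola 2001, §5 p. 291: the growth of the leading coefficients `b_n` from Theorem 3.1

Topic `Literature/NumberTheory/Irrationality/RhinViola2001`. PROVED companion (theorems and ONE definition, the
printed bound; no named fact, no `sorry`) to `Theorem31Proofs.lean` (`theorem31_holds`: `b = Ĩ`). Source read on the
page: G. Rhin, C. Viola, *The group structure for ζ(3)*, Acta Arith. **97** (2001) 269–293 [RhinViola2001], §5
p. 291 (held text `paper:doi-10-4064-aa97-3-6`, p0023) — the USE of Theorem 3.1: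

"From Theorem 3.1 we get, for any `ρ₁, ρ₂, ρ₃ > 0` and any `n ≥ 1`,
`(1/n) log|b_n| ≤ log( ρ₁^h (1+ρ₁)^l (ρ₁^{−1}+ρ₂)^k (1+ρ₁^{−1}+ρ₂)^s ((ρ₁ρ₂)^{−1}+ρ₃)^j (1+(ρ₁ρ₂)^{−1}+ρ₃)^q
 / (ρ₁ρ₂ρ₃)^{q+h−r} ) = log( (1+u)^l (1+v)^k (1+u+v)^s (1+w)^j (1+v+w)^q / (u^{s+k−h} v^{j+q} w^{q+h−r}) )`,
where we have put `ρ₁ = u, ρ₁ρ₂ = v, ρ₁ρ₂ρ₃ = w`. With the change of variables `u = −x, v = xy − 1,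
w = (1 − xy)z − 1`, we get … `= |f(x,y,z)|`. Therefore (5.17)
`limsup_{n→∞} (1/n) log|b_n| ≤ min_{x,y,z<0, xy>1, z<(1−xy)^{−1}} log|f(x,y,z)|`",
`f(x,y,z) = x^h(1−x)^l y^k(1−y)^s z^j(1−z)^q/(1−(1−xy)z)^{q+h−r}` ((5.15)), `I_n = I(hn,…,sn) = a_n + 2b_nζ(3)` ((5.2)).

## What is typed (NON-ASYMPTOTIC forms, which imply the printed `(1/n) log` and `limsup` statements)

* `torusBound P ρ₁ ρ₂ ρ₃` — the printed bound `ρ₁^h(1+ρ₁)^l⋯/(ρ₁ρ₂ρ₃)^{q+h−r}` (DEFINITION);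
* `norm_contourIntegrand_le` — on the three circles of (3.1) the integrand has modulus
  `≤ torusBound/(ρ₁ρ₂ρ₃)^{1}·…` (precisely: `|x| = ρ₁`, `|1−xy| = ρ₁ρ₂`, `|1−(1−xy)z| = ρ₁ρ₂ρ₃` exactly, and
  `|1−x| ≤ 1+ρ₁`, `|y| ≤ ρ₁^{−1}+ρ₂`, `|1−y| ≤ 1+ρ₁^{−1}+ρ₂`, `|z| ≤ (ρ₁ρ₂)^{−1}+ρ₃`, `|1−z| ≤ 1+(ρ₁ρ₂)^{−1}+ρ₃`);
* `norm_contourI_le` — **`|Ĩ(P)| ≤ torusBound P ρ`** for every non-negative `P` and all radii (three applications of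
  `‖∮_{|ζ−c|=R} g‖ ≤ 2πR·sup‖g‖`);
* `abs_b_le` — by Theorem 3.1 (`Theorem31.contourI_eq_b`): `|b| ≤ torusBound P ρ` for any representation
  `I(P) = a + 2bζ(3)`; `torusBound_scale` — `torusBound(P_n) = torusBound(P)^n`; **`abs_b_scale_le`** —
  `|b_n| ≤ torusBound(P)^n` for every `n`, i.e. the display "`(1/n) log|b_n| ≤ log(…)`" (`log_abs_b_scale_le`);
* `torusBound_uvw` — the printed `u, v, w` form; `abs_f_eq_torusBound` + **`abs_b_scale_le_f`** — (5.17) pointwise: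
  `|b_n| ≤ |f(x,y,z)|^n` at EVERY point `x, y, z < 0`, `xy > 1`, `z < (1−xy)^{−1}` (so `limsup (1/n)log|b_n| ≤
  min log|f|` over that region).

This is the `c₁`-leg of the source's `μ(ζ(3)) < 5.513891` ((5.17)–(5.19)); the `c₀`-leg ((5.16), (5.18): the saddle
values) and the `c₂`-leg ((5.14)) are not typed here. HONEST FRAMING (cells pub-zeta5 / zeta5-irr): `ζ(3)`
bookkeeping as printed in 2001; nothing here concerns `ζ(5)`; no irrationality measure is proved in this file.
-/

noncomputable section

open MeasureTheory Set Metric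

namespace Literature.NumberTheory.Irrationality.RhinViola2001

namespace Theorem31

open Literature.NumberTheory.Transcendental (zetaValue)
open Theorem21

/-! ### The printed bound -/

/-- **The bound of p. 291**: `ρ₁^h (1+ρ₁)^l (ρ₁^{−1}+ρ₂)^k (1+ρ₁^{−1}+ρ₂)^s ((ρ₁ρ₂)^{−1}+ρ₃)^j (1+(ρ₁ρ₂)^{−1}+ρ₃)^q
/ (ρ₁ρ₂ρ₃)^{q+h−r}` (integer exponents, as the parameters). [cite: RhinViola2001, §5 p. 291 (display after (5.16))] -/
def torusBound (P : Params) (ρ₁ ρ₂ ρ₃ : ℝ) : ℝ :=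
  ρ₁ ^ P.h * (1 + ρ₁) ^ P.l * (ρ₁⁻¹ + ρ₂) ^ P.k * (1 + ρ₁⁻¹ + ρ₂) ^ P.s * ((ρ₁ * ρ₂)⁻¹ + ρ₃) ^ P.j *
    (1 + (ρ₁ * ρ₂)⁻¹ + ρ₃) ^ P.q / (ρ₁ * ρ₂ * ρ₃) ^ (P.q + P.h - P.r)

/-- The bound is positive for positive radii. [cite: RhinViola2001, §5 p. 291] -/
theorem torusBound_pos (P : Params) {ρ₁ ρ₂ ρ₃ : ℝ} (h₁ : 0 < ρ₁) (h₂ : 0 < ρ₂) (h₃ : 0 < ρ₃) :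
    0 < torusBound P ρ₁ ρ₂ ρ₃ := by
  unfold torusBound
  positivity

/-! ### The modulus of the integrand on the three circles -/

/-- On `C_x`: `|y| ≤ ρ₁^{−1} + ρ₂`. [cite: RhinViola2001, §5 p. 291] -/
theorem norm_y_le {x y : ℂ} {ρ₁ ρ₂ : ℝ} (hx : x ∈ sphere (0 : ℂ) ρ₁) (hy : y ∈ sphere (1 / x) ρ₂) :
    ‖y‖ ≤ ρ₁⁻¹ + ρ₂ := by
  rw [mem_sphere, dist_eq_norm, sub_zero] at hx
  rw [mem_sphere, dist_eq_norm] at hy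
  calc ‖y‖ = ‖1 / x + (y - 1 / x)‖ := by ring_nf
    _ ≤ ‖1 / x‖ + ‖y - 1 / x‖ := norm_add_le _ _
    _ = ρ₁⁻¹ + ρ₂ := by rw [hy, norm_div, norm_one, hx, one_div]

/-- On `C_x`: `|1 − xy| = ρ₁ρ₂` (since `1 − xy = −x(y − 1/x)`). [cite: RhinViola2001, §3 p. 277 ("`|1 − xy| = ρ₁ρ₂`")] -/
theorem norm_one_sub_mul {x y : ℂ} {ρ₁ ρ₂ : ℝ} (h₁ : 0 < ρ₁) (hx : x ∈ sphere (0 : ℂ) ρ₁)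
    (hy : y ∈ sphere (1 / x) ρ₂) : ‖1 - x * y‖ = ρ₁ * ρ₂ := by
  have hx0 : x ≠ 0 := ne_zero_of_mem_sphere_zero h₁ hx
  rw [mem_sphere, dist_eq_norm, sub_zero] at hx
  rw [mem_sphere, dist_eq_norm] at hy
  rw [one_sub_mul_eq hx0 y, norm_mul, norm_neg, hx, hy]

/-- On `C_{x,y}`: `|z| ≤ (ρ₁ρ₂)^{−1} + ρ₃`. [cite: RhinViola2001, §5 p. 291] -/
theorem norm_z_le {x y z : ℂ} {ρ₁ ρ₂ ρ₃ : ℝ} (h₁ : 0 < ρ₁) (hx : x ∈ sphere (0 : ℂ) ρ₁)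
    (hy : y ∈ sphere (1 / x) ρ₂) (hz : z ∈ sphere (1 - x * y)⁻¹ ρ₃) : ‖z‖ ≤ (ρ₁ * ρ₂)⁻¹ + ρ₃ := by
  have hw := norm_one_sub_mul h₁ hx hy
  rw [mem_sphere, dist_eq_norm] at hz
  calc ‖z‖ = ‖(1 - x * y)⁻¹ + (z - (1 - x * y)⁻¹)‖ := by ring_nf
    _ ≤ ‖(1 - x * y)⁻¹‖ + ‖z - (1 - x * y)⁻¹‖ := norm_add_le _ _
    _ = (ρ₁ * ρ₂)⁻¹ + ρ₃ := by rw [hz, norm_inv, hw]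

/-- On `C_{x,y}`: `|1 − (1−xy)z| = ρ₁ρ₂ρ₃`. [cite: RhinViola2001, §5 p. 291 (the factor `(ρ₁ρ₂ρ₃)^{q+h−r}`)] -/
theorem norm_denom {x y z : ℂ} {ρ₁ ρ₂ ρ₃ : ℝ} (h₁ : 0 < ρ₁) (h₂ : 0 < ρ₂) (hx : x ∈ sphere (0 : ℂ) ρ₁)
    (hy : y ∈ sphere (1 / x) ρ₂) (hz : z ∈ sphere (1 - x * y)⁻¹ ρ₃) :
    ‖1 - (1 - x * y) * z‖ = ρ₁ * ρ₂ * ρ₃ := by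
  have hw := norm_one_sub_mul h₁ hx hy
  have hw0 : 1 - x * y ≠ 0 := by
    intro h0; rw [h0, norm_zero] at hw; exact (mul_pos h₁ h₂).ne' hw.symm
  rw [mem_sphere, dist_eq_norm] at hz
  have h1 : 1 - (1 - x * y) * z = -(1 - x * y) * (z - (1 - x * y)⁻¹) := by field_simp; ring
  rw [h1, norm_mul, norm_neg, hw, hz]

/-- **The modulus of the integrand on the circles** (natural parameters): with `e = q+h−r+1`,
`|x^h(1−x)^l y^k(1−y)^s z^j(1−z)^q/(1−(1−xy)z)^e|
 ≤ ρ₁^h(1+ρ₁)^l(ρ₁^{−1}+ρ₂)^k(1+ρ₁^{−1}+ρ₂)^s((ρ₁ρ₂)^{−1}+ρ₃)^j(1+(ρ₁ρ₂)^{−1}+ρ₃)^q/(ρ₁ρ₂ρ₃)^e`.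
[cite: RhinViola2001, §5 p. 291] -/
theorem norm_contourIntegrand_le (h j k l m q r s : ℕ) {ρ₁ ρ₂ ρ₃ : ℝ} (h₁ : 0 < ρ₁) (h₂ : 0 < ρ₂)
    (h₃ : 0 < ρ₃) {x y z : ℂ} (hx : x ∈ sphere (0 : ℂ) ρ₁) (hy : y ∈ sphere (1 / x) ρ₂)
    (hz : z ∈ sphere (1 - x * y)⁻¹ ρ₃) :
    ‖contourIntegrand (ofNat h j k l m q r s) x y z‖
      ≤ ρ₁ ^ h * (1 + ρ₁) ^ l * (ρ₁⁻¹ + ρ₂) ^ k * (1 + ρ₁⁻¹ + ρ₂) ^ s *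
          (((ρ₁ * ρ₂)⁻¹ + ρ₃) ^ j * (1 + (ρ₁ * ρ₂)⁻¹ + ρ₃) ^ q) / (ρ₁ * ρ₂ * ρ₃) ^ ((q : ℤ) + h - r + 1) := by
  have hD := norm_denom h₁ h₂ hx hy hz
  have hyb := norm_y_le hx hy
  have hzb := norm_z_le h₁ hx hy hz
  have hxn : ‖x‖ = ρ₁ := by rw [mem_sphere, dist_eq_norm, sub_zero] at hx; exact hx
  have h1x : ‖1 - x‖ ≤ 1 + ρ₁ := (norm_sub_le _ _).trans (by rw [norm_one, hxn])
  have h1y : ‖1 - y‖ ≤ 1 + ρ₁⁻¹ + ρ₂ := by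
    have := norm_sub_le (1 : ℂ) y; rw [norm_one] at this; linarith
  have h1z : ‖1 - z‖ ≤ 1 + (ρ₁ * ρ₂)⁻¹ + ρ₃ := by
    have := norm_sub_le (1 : ℂ) z; rw [norm_one] at this; linarith
  rw [contourIntegrand_ofNat, norm_mul, norm_div, norm_zpow, hD]
  simp only [norm_mul, norm_pow, hxn]
  rw [← mul_div_assoc]
  have hpos : 0 < (ρ₁ * ρ₂ * ρ₃) ^ ((q : ℤ) + h - r + 1) := zpow_pos (by positivity) _
  refine div_le_div_of_nonneg_right ?_ hpos.le
  gcongr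

/-- **`|Ĩ(P)| ≤` the printed bound**, for every non-negative parameter set and all radii `ρ₁, ρ₂, ρ₃ > 0`
(three times `‖∮_{|ζ−c|=R} g dζ‖ ≤ 2πR·sup‖g‖`, and `(2π)^{−3}·2πρ₁·2πρ₂·2πρ₃·(ρ₁ρ₂ρ₃)^{−(q+h−r+1)} = (ρ₁ρ₂ρ₃)^{−(q+h−r)}`).
[cite: RhinViola2001, §5 p. 291 (display after (5.16))] -/
theorem norm_contourI_le {P : Params} (hP : P.Nonneg) {ρ₁ ρ₂ ρ₃ : ℝ} (h₁ : 0 < ρ₁) (h₂ : 0 < ρ₂)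
    (h₃ : 0 < ρ₃) : ‖contourI P ρ₁ ρ₂ ρ₃‖ ≤ torusBound P ρ₁ ρ₂ ρ₃ := by
  obtain ⟨h, j, k, l, m, q, r, s, rfl⟩ := exists_eq_ofNat hP
  set K : ℝ := ρ₁ ^ h * (1 + ρ₁) ^ l * (ρ₁⁻¹ + ρ₂) ^ k * (1 + ρ₁⁻¹ + ρ₂) ^ s *
      (((ρ₁ * ρ₂)⁻¹ + ρ₃) ^ j * (1 + (ρ₁ * ρ₂)⁻¹ + ρ₃) ^ q) / (ρ₁ * ρ₂ * ρ₃) ^ ((q : ℤ) + h - r + 1) with hK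
  -- the three nested estimates
  have hz : ∀ x ∈ sphere (0 : ℂ) ρ₁, ∀ y ∈ sphere (1 / x) ρ₂,
      ‖∮ z in C((1 - x * y)⁻¹, ρ₃), contourIntegrand (ofNat h j k l m q r s) x y z‖ ≤ 2 * Real.pi * ρ₃ * K :=
    fun x hx y hy => circleIntegral.norm_integral_le_of_norm_le_const h₃.le
      fun z hz => norm_contourIntegrand_le h j k l m q r s h₁ h₂ h₃ hx hy hz
  have hy : ∀ x ∈ sphere (0 : ℂ) ρ₁,
      ‖∮ y in C(1 / x, ρ₂), ∮ z in C((1 - x * y)⁻¹, ρ₃), contourIntegrand (ofNat h j k l m q r s) x y z‖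
        ≤ 2 * Real.pi * ρ₂ * (2 * Real.pi * ρ₃ * K) :=
    fun x hx => circleIntegral.norm_integral_le_of_norm_le_const h₂.le fun y hy => hz x hx y hy
  have hx : ‖∮ x in C(0, ρ₁), ∮ y in C(1 / x, ρ₂), ∮ z in C((1 - x * y)⁻¹, ρ₃),
      contourIntegrand (ofNat h j k l m q r s) x y z‖ ≤ 2 * Real.pi * ρ₁ * (2 * Real.pi * ρ₂ * (2 * Real.pi * ρ₃ * K)) :=
    circleIntegral.norm_integral_le_of_norm_le_const h₁.le fun x hx => hy x hx
  unfold contourI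
  rw [norm_mul]
  have hc : ‖(1 / (2 * Real.pi * Complex.I) ^ 3 : ℂ)‖ = 1 / (2 * Real.pi) ^ 3 := by
    simp [Real.pi_pos.le]
  rw [hc]
  calc 1 / (2 * Real.pi) ^ 3 * ‖∮ x in C(0, ρ₁), ∮ y in C(1 / x, ρ₂), ∮ z in C((1 - x * y)⁻¹, ρ₃),
        contourIntegrand (ofNat h j k l m q r s) x y z‖
      ≤ 1 / (2 * Real.pi) ^ 3 * (2 * Real.pi * ρ₁ * (2 * Real.pi * ρ₂ * (2 * Real.pi * ρ₃ * K))) :=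
        mul_le_mul_of_nonneg_left hx (by positivity)
    _ = torusBound (ofNat h j k l m q r s) ρ₁ ρ₂ ρ₃ := by
        have hpi : Real.pi ≠ 0 := Real.pi_ne_zero
        have hρ : ρ₁ * ρ₂ * ρ₃ ≠ 0 := by positivity
        simp only [torusBound, ofNat, zpow_natCast, hK]
        rw [zpow_add_one₀ hρ]
        field_simp

/-! ### `b` and `b_n` -/

/-- **`|b| ≤` the printed bound** (Theorem 3.1: `b = Ĩ`): for non-negative balanced `P`, any representation
`I(P) = a + 2bζ(3)` (`a ∈ ℚ`, `b ∈ ℤ`) and all radii. [cite: RhinViola2001, §5 p. 291 ("From Theorem 3.1 we get …")] -/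
theorem abs_b_le {P : Params} (hN : P.Nonneg) (hB : P.Balanced) {a : ℚ} {b : ℤ}
    (hab : I P = a + 2 * b * zetaValue 3) {ρ₁ ρ₂ ρ₃ : ℝ} (h₁ : 0 < ρ₁) (h₂ : 0 < ρ₂) (h₃ : 0 < ρ₃) :
    |(b : ℝ)| ≤ torusBound P ρ₁ ρ₂ ρ₃ := by
  have h := norm_contourI_le hN h₁ h₂ h₃
  rwa [contourI_eq_b hN hB hab h₁ h₂ h₃, Complex.norm_intCast] at h

/-- The bound is multiplicative in the parameters: `torusBound(P_n) = torusBound(P)^n` (`P_n = (hn,…,sn)`, (5.2)).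
[cite: RhinViola2001, §5 (5.2) and p. 291] -/
theorem torusBound_scale (P : Params) (n : ℕ) (ρ₁ ρ₂ ρ₃ : ℝ) :
    torusBound (P.scale n) ρ₁ ρ₂ ρ₃ = torusBound P ρ₁ ρ₂ ρ₃ ^ n := by
  simp only [torusBound, Params.scale]
  rw [show (n : ℤ) * P.q + n * P.h - n * P.r = (P.q + P.h - P.r) * n by ring]
  simp only [mul_comm (n : ℤ), zpow_mul, zpow_natCast]
  rw [div_pow]
  simp only [mul_pow]

/-- **"for any `ρ₁, ρ₂, ρ₃ > 0` and any `n ≥ 1`, `(1/n) log|b_n| ≤ log(…)`"**, in the form `|b_n| ≤ (…)^n` for EVERY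
`n ≥ 0`: for non-negative balanced `P` and any representation `I(P_n) = a_n + 2b_nζ(3)`.
[cite: RhinViola2001, §5 p. 291 (display after (5.16))] -/
theorem abs_b_scale_le {P : Params} (hN : P.Nonneg) (hB : P.Balanced) (n : ℕ) {a : ℚ} {b : ℤ}
    (hab : I (P.scale n) = a + 2 * b * zetaValue 3) {ρ₁ ρ₂ ρ₃ : ℝ} (h₁ : 0 < ρ₁) (h₂ : 0 < ρ₂)
    (h₃ : 0 < ρ₃) : |(b : ℝ)| ≤ torusBound P ρ₁ ρ₂ ρ₃ ^ n := by
  rw [← torusBound_scale P n ρ₁ ρ₂ ρ₃]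
  exact abs_b_le (nonneg_scale hN (by positivity)) (balanced_scale hB n) hab h₁ h₂ h₃

/-- The printed logarithmic form: `(1/n) log|b_n| ≤ log(torusBound)` for `n ≥ 1` and `b_n ≠ 0`.
[cite: RhinViola2001, §5 p. 291 (display after (5.16))] -/
theorem log_abs_b_scale_le {P : Params} (hN : P.Nonneg) (hB : P.Balanced) {n : ℕ} (hn : 1 ≤ n) {a : ℚ}
    {b : ℤ} (hab : I (P.scale n) = a + 2 * b * zetaValue 3) (hb : b ≠ 0) {ρ₁ ρ₂ ρ₃ : ℝ} (h₁ : 0 < ρ₁)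
    (h₂ : 0 < ρ₂) (h₃ : 0 < ρ₃) :
    Real.log |(b : ℝ)| / n ≤ Real.log (torusBound P ρ₁ ρ₂ ρ₃) := by
  have hT := torusBound_pos P h₁ h₂ h₃
  have hb' : 0 < |(b : ℝ)| := abs_pos.mpr (by exact_mod_cast hb)
  have h := Real.log_le_log hb' (abs_b_scale_le hN hB n hab h₁ h₂ h₃)
  rw [Real.log_pow] at h
  have hn' : (0 : ℝ) < n := by exact_mod_cast hn
  rwa [div_le_iff₀ hn', mul_comm]

/-! ### The `u, v, w` form and (5.17) -/

/-- **The `u, v, w` form**: with `ρ₁ = u`, `ρ₁ρ₂ = v`, `ρ₁ρ₂ρ₃ = w`, the bound is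
`(1+u)^l (1+v)^k (1+u+v)^s (1+w)^j (1+v+w)^q / (u^{s+k−h} v^{j+q} w^{q+h−r})`.
[cite: RhinViola2001, §5 p. 291 ("where we have put `ρ₁ = u, ρ₁ρ₂ = v, ρ₁ρ₂ρ₃ = w`")] -/
theorem torusBound_uvw (P : Params) {u v w : ℝ} (hu : 0 < u) (hv : 0 < v) (hw : 0 < w) :
    torusBound P u (v / u) (w / v)
      = (1 + u) ^ P.l * (1 + v) ^ P.k * (1 + u + v) ^ P.s * (1 + w) ^ P.j * (1 + v + w) ^ P.q /
          (u ^ (P.s + P.k - P.h) * v ^ (P.j + P.q) * w ^ (P.q + P.h - P.r)) := by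
  have hu0 : u ≠ 0 := hu.ne'
  have hv0 : v ≠ 0 := hv.ne'
  have hw0 : w ≠ 0 := hw.ne'
  have e1 : u⁻¹ + v / u = (1 + v) / u := by field_simp
  have e2 : 1 + u⁻¹ + v / u = (1 + u + v) / u := by field_simp; ring
  have e3 : (u * (v / u))⁻¹ + w / v = (1 + w) / v := by field_simp
  have e4 : 1 + (u * (v / u))⁻¹ + w / v = (1 + v + w) / v := by field_simp; ring
  have e5 : u * (v / u) * (w / v) = w := by field_simp
  rw [torusBound, e1, e2, e3, e4, e5, div_zpow, div_zpow, div_zpow, div_zpow,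
    zpow_sub₀ hu0, zpow_add₀ hu0, zpow_add₀ hv0]
  field_simp

/-- The function (5.15): `f(x,y,z) = x^h(1−x)^l y^k(1−y)^s z^j(1−z)^q/(1−(1−xy)z)^{q+h−r}` (real variables, integer
exponents). [cite: RhinViola2001, §5 (5.15)] -/
def fRV (P : Params) (x y z : ℝ) : ℝ :=
  x ^ P.h * (1 - x) ^ P.l * y ^ P.k * (1 - y) ^ P.s * z ^ P.j * (1 - z) ^ P.q /
    (1 - (1 - x * y) * z) ^ (P.q + P.h - P.r)

/-- "With the change of variables `u = −x, v = xy − 1, w = (1 − xy)z − 1`, we get … `= |f(x,y,z)|`": at a point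
`x, y, z < 0`, `xy > 1`, `z < (1−xy)^{−1}`, the `u,v,w` bound is `|f(x,y,z)|`. [cite: RhinViola2001, §5 p. 291] -/
theorem abs_fRV_eq_torusBound (P : Params) {x y z : ℝ} (hx : x < 0) (hy : y < 0) (hz : z < 0) (hxy : 1 < x * y)
    (hz' : z < (1 - x * y)⁻¹) :
    |fRV P x y z| = torusBound P (-x) ((x * y - 1) / (-x)) (((1 - x * y) * z - 1) / (x * y - 1)) := by
  have hu : 0 < -x := neg_pos.mpr hx
  have hv : 0 < x * y - 1 := by linarith
  have hneg : 1 - x * y < 0 := by linarith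
  have hw : 0 < (1 - x * y) * z - 1 := by
    have : (1 - x * y) * z > (1 - x * y) * (1 - x * y)⁻¹ := mul_lt_mul_of_neg_left hz' hneg
    rw [mul_inv_cancel₀ hneg.ne] at this
    linarith
  rw [torusBound_uvw P hu hv hw, fRV]
  have hx0 : x ≠ 0 := hx.ne
  have hv0 : x * y - 1 ≠ 0 := hv.ne'
  -- the absolute values of the seven factors
  have a1 : |x| = -x := abs_of_neg hx
  have a2 : |1 - x| = 1 + -x := by rw [abs_of_pos (by linarith)]; ring
  have a3 : |y| = (1 + (x * y - 1)) / -x := by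
    rw [abs_of_neg hy]; field_simp; ring
  have a4 : |1 - y| = (1 + -x + (x * y - 1)) / -x := by
    rw [abs_of_pos (by linarith)]; field_simp; ring
  have a5 : |z| = (1 + ((1 - x * y) * z - 1)) / (x * y - 1) := by
    rw [abs_of_neg hz]; field_simp; ring
  have a6 : |1 - z| = (1 + (x * y - 1) + ((1 - x * y) * z - 1)) / (x * y - 1) := by
    rw [abs_of_pos (by linarith)]; field_simp; ring
  have a7 : |1 - (1 - x * y) * z| = (1 - x * y) * z - 1 := by
    rw [abs_of_neg (by linarith)]; ring
  rw [abs_div, abs_zpow, a7]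
  simp only [abs_mul, abs_zpow, a1, a2, a3, a4, a5, a6]
  rw [div_zpow, div_zpow, div_zpow, div_zpow, zpow_sub₀ hu.ne', zpow_add₀ hu.ne', zpow_add₀ hv0]
  field_simp

/-- **(5.17), pointwise and non-asymptotic**: for non-negative balanced `P`, every `n`, any representation
`I(P_n) = a_n + 2b_nζ(3)` and EVERY point `x, y, z < 0` with `xy > 1`, `z < (1−xy)^{−1}`: `|b_n| ≤ |f(x,y,z)|^n`
(hence `limsup (1/n) log|b_n| ≤ min log|f|` over the region). [cite: RhinViola2001, §5 (5.17)] -/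
theorem abs_b_scale_le_f {P : Params} (hN : P.Nonneg) (hB : P.Balanced) (n : ℕ) {a : ℚ} {b : ℤ}
    (hab : I (P.scale n) = a + 2 * b * zetaValue 3) {x y z : ℝ} (hx : x < 0) (hy : y < 0) (hz : z < 0)
    (hxy : 1 < x * y) (hz' : z < (1 - x * y)⁻¹) : |(b : ℝ)| ≤ |fRV P x y z| ^ n := by
  rw [abs_fRV_eq_torusBound P hx hy hz hxy hz']
  have hu : 0 < -x := neg_pos.mpr hx
  have hv : 0 < x * y - 1 := by linarith
  have hneg : 1 - x * y < 0 := by linarith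
  have hw : 0 < (1 - x * y) * z - 1 := by
    have : (1 - x * y) * z > (1 - x * y) * (1 - x * y)⁻¹ := mul_lt_mul_of_neg_left hz' hneg
    rw [mul_inv_cancel₀ hneg.ne] at this
    linarith
  exact abs_b_scale_le hN hB n hab hu (div_pos hv hu) (div_pos hw hv)


/-! ### The record parameters of §5: `c₁` -/

/-- The record parameters `(16,17,19,15,12,11,9,13)` of §5 are non-negative and balanced (`16+12 = 19+9`,
`17+11 = 15+13`). [cite: RhinViola2001, §5 p. 292] -/
theorem rvChoice_nonneg_balanced : rvChoice.Nonneg ∧ rvChoice.Balanced := by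
  refine ⟨?_, ?_⟩
  · simp only [Params.Nonneg, rvChoice]; omega
  · simp only [Params.Balanced, rvChoice]; omega

/-- **`c₁` for the record parameters, certified**: with the rational point `(x,y,z) = (−63/20, −91/50, −26/25)` of the
region `x,y,z < 0`, `xy > 1`, `z < (1−xy)^{−1}` (next to the printed stationary point `(x₁,y₁,z₁) =
(−3.15075681…, −1.81763478…, −1.03862011…)`), `|f(x,y,z)| < 1122043·10^{15}`, i.e. `log|f| = 48.46943…` against the
printed `c₁ = log|f(x₁,y₁,z₁)| = 48.46940964…`; hence `|b_n| ≤ (1122043·10^{15})^n` for EVERY `n` and any representation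
`I_n = a_n + 2b_nζ(3)` of the record integrals. [cite: RhinViola2001, §5 (5.17), (5.19) and p. 293 ("`c₁ = 48.46940964…`")] -/
theorem record_abs_b_le (n : ℕ) {a : ℚ} {b : ℤ} (hab : I (rvChoice.scale n) = a + 2 * b * zetaValue 3) :
    |(b : ℝ)| ≤ (1122043 * 10 ^ 15 : ℝ) ^ n := by
  have hx : (-63 / 20 : ℝ) < 0 := by norm_num
  have hy : (-91 / 50 : ℝ) < 0 := by norm_num
  have hz : (-26 / 25 : ℝ) < 0 := by norm_num
  have hxy : (1 : ℝ) < (-63 / 20) * (-91 / 50) := by norm_num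
  have hz' : (-26 / 25 : ℝ) < (1 - (-63 / 20) * (-91 / 50))⁻¹ := by norm_num
  have h := abs_b_scale_le_f rvChoice_nonneg_balanced.1 rvChoice_nonneg_balanced.2 n hab hx hy hz hxy hz'
  refine h.trans (pow_le_pow_left₀ (abs_nonneg _) ?_ n)
  have hval : fRV rvChoice (-63 / 20) (-91 / 50) (-26 / 25)
      = ((-63 / 20 : ℝ)) ^ (16 : ℕ) * (1 - (-63 / 20 : ℝ)) ^ (15 : ℕ) * ((-91 / 50 : ℝ)) ^ (19 : ℕ) *
          (1 - (-91 / 50 : ℝ)) ^ (13 : ℕ) * ((-26 / 25 : ℝ)) ^ (17 : ℕ) * (1 - (-26 / 25 : ℝ)) ^ (11 : ℕ) /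
          (1 - (1 - (-63 / 20 : ℝ) * (-91 / 50)) * (-26 / 25)) ^ (18 : ℕ) := by
    rw [fRV]
    simp only [rvChoice, show ((11 : ℤ) + 16 - 9) = ((18 : ℕ) : ℤ) by norm_num, zpow_natCast]
    norm_cast
  rw [hval, abs_le]
  constructor <;> norm_num

/-- **`c₁` for the record parameters, to the printed digits**: at the rational point
`(x,y,z) = (−78769/25000, −181763/100000, −51931/50000) = (−3.15076, −1.81763, −1.03862)` (the printed stationary point
`(x₁,y₁,z₁) = (−3.15075681…, −1.81763478…, −1.03862011…)` rounded to six digits) one has `|f(x,y,z)| < 1122012·10^{15}`,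
`log(1122012·10^{15}) = 48.4694105…` against the printed `c₁ = 48.46940964…`; hence `|b_n| ≤ (1122012·10^{15})^n` for every
`n`. This is the form usable in Theorem 5.1: with the printed `c₀ = 47.15472079…`, `c₂ = 29.81231469…` the bound
`μ(ζ(3)) ≤ (c₀+c₁)/(c₀−c₂) < 5.513891` needs `c₁ < 5.513891·(c₀−c₂) − c₀ = 48.469416…`, which `48.4694105` meets and the
coarser `record_abs_b_le` (`48.469438`) does not. [cite: RhinViola2001, §5 (5.17), (5.19), Theorem 5.1 and p. 293] -/
theorem record_abs_b_le_sharp (n : ℕ) {a : ℚ} {b : ℤ} (hab : I (rvChoice.scale n) = a + 2 * b * zetaValue 3) :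
    |(b : ℝ)| ≤ (1122012 * 10 ^ 15 : ℝ) ^ n := by
  have hx : (-78769 / 25000 : ℝ) < 0 := by norm_num
  have hy : (-181763 / 100000 : ℝ) < 0 := by norm_num
  have hz : (-51931 / 50000 : ℝ) < 0 := by norm_num
  have hxy : (1 : ℝ) < (-78769 / 25000) * (-181763 / 100000) := by norm_num
  have hz' : (-51931 / 50000 : ℝ) < (1 - (-78769 / 25000) * (-181763 / 100000))⁻¹ := by norm_num
  have h := abs_b_scale_le_f rvChoice_nonneg_balanced.1 rvChoice_nonneg_balanced.2 n hab hx hy hz hxy hz'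
  refine h.trans (pow_le_pow_left₀ (abs_nonneg _) ?_ n)
  have hval : fRV rvChoice (-78769 / 25000) (-181763 / 100000) (-51931 / 50000)
      = ((-78769 / 25000 : ℝ)) ^ (16 : ℕ) * (1 - (-78769 / 25000 : ℝ)) ^ (15 : ℕ) *
          ((-181763 / 100000 : ℝ)) ^ (19 : ℕ) * (1 - (-181763 / 100000 : ℝ)) ^ (13 : ℕ) *
          ((-51931 / 50000 : ℝ)) ^ (17 : ℕ) * (1 - (-51931 / 50000 : ℝ)) ^ (11 : ℕ) /
          (1 - (1 - (-78769 / 25000 : ℝ) * (-181763 / 100000)) * (-51931 / 50000)) ^ (18 : ℕ) := by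
    rw [fRV]
    simp only [rvChoice, show ((11 : ℤ) + 16 - 9) = ((18 : ℕ) : ℤ) by norm_num, zpow_natCast]
    norm_cast
  rw [hval, abs_le]
  constructor <;> norm_num

end Theorem31

end Literature.NumberTheory.Irrationality.RhinViola2001
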